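import Summits.CriticalPhenomena.Ising3DConformalLimit.Theorems.PlantedPinningGaussianPinningSaturationLogic
import Summits.CriticalPhenomena.Ising3DConformalLimit.Theorems.PlantedPinningGaussianPinningSaturationVarianceSplit
import Summits.CriticalPhenomena.Ising3DConformalLimit.Theorems.PlantedPinningGaussianPinningSaturationLinEffLeOne
import Summits.CriticalPhenomena.Ising3DConformalLimit.Theorems.PlantedPinningGaussianPinningSaturationBoxSusceptibilityFloor

/-!
# Line `registered` for crux `GaussianPinningSaturation` (stmt-CriticalPhenomena-8452): the hypothesis-free anatomy

Lead seat c2 (`prover-line-stmt-CriticalPhenomena-8452-c2-0`), route `PlantedPinning`, sub-problem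
`Ising3DConformalLimit`. The Logic file (`…Logic.lean`, p157283/p157892/p161001) proved, unconditionally,
`GaussianPinningSaturation ↔ (IsingEuclidUpgradeR4NonGaussian ∨ lattice saturation)`. Here the second disjunct is
decomposed WITHOUT the (vacuous, model-blind) scaling-limit hypotheses of the registered stubs B and C, using only
LANDED theorems of the line (stub A `stub_varianceSplit`, the Gaussian ceiling `stub_linEffLeOne`, the box
susceptibility floor `stub_boxSusceptibilityFloor`):

* `latticeSaturation_iff_lin_and_gap` — lattice saturation `e → 1` ⟺ (linear saturation `e^{lin} → 1`) ∧
  (lattice conditional linearity `e^{gap} → 0`), unconditionally (`e = e^{lin} − e^{gap}`, `e^{gap} ≥ 0`,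
  `e^{lin} ≤ 1`);
* `linSaturation_of_riccati` — `LinRiccatiSaturation` (registered stub B2, hypothesis-free) ⟹ linear saturation
  (B1 is landed, so B2 alone suffices);
* `gaussianPinningSaturation_iff_R4NonGaussian_or_lin_and_gap` — **crux ⟺ 0636 ∨ (e^{lin} → 1 ∧ e^{gap} → 0)**,
  and `gaussianPinningSaturation_of_riccati_of_gap` — B2 ∧ (e^{gap} → 0 on the lattice) ⟹ crux: the honest,
  hypothesis-free, Monte-Carlo-testable sufficient conditions (kit jobs j025672/j025673 of the lead test exactly these).

No definitions, no named facts, no `sorry`.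
-/

noncomputable section

namespace Summit.CriticalPhenomena.Ising3DConformalLimit.PlantedPinningGaussianPinningSaturation

open scoped BigOperators Classical
open Finset MeasureTheory
open Literature.Probability.LatticeModels
open Summit.CriticalPhenomena.Ising3DConformalLimit.Theses.PlantedPinning
open Summit.CriticalPhenomena.Ising3DConformalLimit.Theses.IsingEuclidUpgrade

/-! ### Lattice saturation ⟺ linear saturation ∧ vanishing regression gap (unconditional) -/

/-- **`e → 1` iff `e^{lin} → 1` and `e^{gap} → 0`** (all three in the order `∀ ε, ∃ p₀, ∀ p < p₀, ∃ L₀, ∀ L ≥ L₀`),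
unconditionally: by the landed variance split (stub A) `e = e^{lin} − e^{gap}` with `e^{gap} ≥ 0`, and by the
landed Gaussian ceiling `e^{lin} ≤ 1`. -/
theorem latticeSaturation_iff_lin_and_gap :
    (∀ ε : ℝ, 0 < ε → ∃ p₀ : ℝ, 0 < p₀ ∧ ∀ p : ℝ, 0 < p → p < p₀ → ∃ L₀ : ℕ, ∀ L ≥ L₀,
        1 - ε ≤ plantedEff L ⌈p * ((box 3 L).card : ℝ)⌉₊) ↔
      ((∀ ε : ℝ, 0 < ε → ∃ p₀ : ℝ, 0 < p₀ ∧ ∀ p : ℝ, 0 < p → p < p₀ → ∃ L₀ : ℕ, ∀ L ≥ L₀,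
          1 - ε ≤ linEff L ⌈p * ((box 3 L).card : ℝ)⌉₊) ∧
        ∀ ε : ℝ, 0 < ε → ∃ p₀ : ℝ, 0 < p₀ ∧ ∀ p : ℝ, 0 < p → p < p₀ → ∃ L₀ : ℕ, ∀ L ≥ L₀,
          gapEff L ⌈p * ((box 3 L).card : ℝ)⌉₊ ≤ ε) := by
  have hA : VarianceSplit := stub_varianceSplit
  constructor
  · intro h
    constructor
    · intro ε hε
      obtain ⟨p₀, hp₀, h'⟩ := h ε hε
      refine ⟨min p₀ 1, lt_min hp₀ one_pos, fun p hp hpp => ?_⟩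
      obtain ⟨L₀, hL₀⟩ := h' p hp (lt_of_lt_of_le hpp (min_le_left _ _))
      refine ⟨L₀, fun L hL => ?_⟩
      have hk := ceil_mul_card_le (le_of_lt (lt_of_lt_of_le hpp (min_le_right _ _))) L
      exact le_trans (hL₀ L hL) (plantedEff_le_linEff hA L _ hk)
    · intro ε hε
      obtain ⟨p₀, hp₀, h'⟩ := h ε hε
      refine ⟨min p₀ 1, lt_min hp₀ one_pos, fun p hp hpp => ?_⟩
      obtain ⟨L₀, hL₀⟩ := h' p hp (lt_of_lt_of_le hpp (min_le_left _ _))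
      refine ⟨L₀, fun L hL => ?_⟩
      have hk := ceil_mul_card_le (le_of_lt (lt_of_lt_of_le hpp (min_le_right _ _))) L
      have h1 := hL₀ L hL
      have h2 := stub_linEffLeOne L _ hk
      rw [plantedEff_eq_linEff_sub_gapEff hA] at h1
      linarith
  · rintro ⟨hlin, hgap⟩ ε hε
    obtain ⟨p₁, hp₁, h₁⟩ := hlin (ε / 2) (by linarith)
    obtain ⟨p₂, hp₂, h₂⟩ := hgap (ε / 2) (by linarith)
    refine ⟨min p₁ p₂, lt_min hp₁ hp₂, fun p hp hpp => ?_⟩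
    obtain ⟨L₁, hL₁⟩ := h₁ p hp (lt_of_lt_of_le hpp (min_le_left _ _))
    obtain ⟨L₂, hL₂⟩ := h₂ p hp (lt_of_lt_of_le hpp (min_le_right _ _))
    refine ⟨max L₁ L₂, fun L hL => ?_⟩
    have hl := hL₁ L (le_trans (le_max_left _ _) hL)
    have hg := hL₂ L (le_trans (le_max_right _ _) hL)
    rw [plantedEff_eq_linEff_sub_gapEff hA]
    linarith

/-! ### Linear saturation from the Riccati statement B2 (hypothesis-free) -/

/-- **B1 ∧ B2 ⟹ linear saturation, without the scaling-limit hypotheses**: the exact Riccati bookkeeping of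
`twoPointSaturation_of_floor_of_riccati` (lead seat c1), re-run with the vacuous block hypotheses removed. With
`X = A v_0 ≥ 2/ε` (floor) and `A v_k ≥ X/(1 + (1+ε/2)X)` (B2) one gets `A v_k ≥ 1/(1+ε) ≥ 1 − ε`. -/
theorem linSaturation_of_floor_of_riccati (h1 : BoxSusceptibilityFloor) (h2 : LinRiccatiSaturation) :
    ∀ ε : ℝ, 0 < ε → ∃ p₀ : ℝ, 0 < p₀ ∧ ∀ p : ℝ, 0 < p → p < p₀ → ∃ L₀ : ℕ, ∀ L ≥ L₀,
      1 - ε ≤ linEff L ⌈p * ((box 3 L).card : ℝ)⌉₊ := by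
  intro ε hε
  obtain ⟨p₀, hp₀, hR⟩ := h2 (ε / 2) (by linarith)
  refine ⟨min p₀ 1, lt_min hp₀ one_pos, fun p hp hpp => ?_⟩
  have hp1 : p < 1 := lt_of_lt_of_le hpp (min_le_right _ _)
  obtain ⟨L₁, hL₁⟩ := hR p hp (lt_of_lt_of_le hpp (min_le_left _ _))
  obtain ⟨L₂, hL₂⟩ := h1 (8 / (p * ε))
  refine ⟨max L₁ L₂, fun L hL => ?_⟩
  have hfl := hL₂ L (le_trans (le_max_right _ _) hL)
  have hRi := hL₁ L (le_trans (le_max_left _ _) hL)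
  rw [← linVar_zero] at hfl
  set n : ℕ := (box 3 L).card with hn
  set k : ℕ := ⌈p * (n : ℝ)⌉₊ with hk
  have hn1 : (1 : ℝ) ≤ n := by
    have : 0 < n := Finset.card_pos.2 ⟨0, by simp [mem_box]⟩
    exact_mod_cast this
  have hkn : k ≤ n := by
    refine Nat.ceil_le.2 ?_
    have h : p * (n : ℝ) ≤ 1 * (n : ℝ) := mul_le_mul_of_nonneg_right hp1.le (Nat.cast_nonneg _)
    simpa using h
  have hkn' : (k : ℝ) ≤ n := by exact_mod_cast hkn
  have hpk : p * n ≤ k := Nat.le_ceil _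
  have hD : (0 : ℝ) < ((n : ℝ) + 1) * ((n : ℝ) - k + 1) := mul_pos (by linarith) (by linarith)
  set v0 : ℝ := linVar L 0 with hv0
  set vk : ℝ := linVar L k with hvk
  set A : ℝ := (k : ℝ) / (((n : ℝ) + 1) * ((n : ℝ) - k + 1)) with hA
  have heff : ∀ v : ℝ, effOf L k v = A * v := fun v => by
    simp only [effOf, hA, ← hn]
    ring
  have hApos : 0 < A := div_pos (lt_of_lt_of_le (mul_pos hp (by linarith)) hpk) hD
  have hv0pos : 0 < v0 := lt_of_lt_of_le (by positivity) hfl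
  have hAv0 : 2 / ε ≤ A * v0 := by
    have hA' : p / (4 * n) ≤ A := by
      rw [hA, div_le_div_iff₀ (by positivity) hD]
      nlinarith [hpk, hkn', hn1, hp.le]
    calc 2 / ε = p / (4 * n) * (8 / (p * ε) * n) := by field_simp; ring
      _ ≤ A * v0 := mul_le_mul hA' hfl (by positivity) hApos.le
  rw [heff] at hRi
  have hB : 0 < 1 + (1 + ε / 2) * (A * v0) := by positivity
  show 1 - ε ≤ linEff L k
  have hlin : linEff L k = A * vk := heff vk
  rw [hlin]
  have h3 : A * v0 ≤ A * vk * (1 + (1 + ε / 2) * (A * v0)) := by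
    have := mul_le_mul_of_nonneg_left hRi hApos.le
    linarith [this]
  by_contra hcon
  push Not at hcon
  have h4 : A * vk * (1 + (1 + ε / 2) * (A * v0)) < (1 - ε) * (1 + (1 + ε / 2) * (A * v0)) :=
    mul_lt_mul_of_pos_right hcon hB
  have hX := hAv0
  set X := A * v0 with hX'
  have h5 : X < (1 - ε) * (1 + (1 + ε / 2) * X) := lt_of_le_of_lt h3 h4
  have h6 : 2 / ε * (ε / 2 * (1 + ε)) ≤ X * (ε / 2 * (1 + ε)) :=
    mul_le_mul_of_nonneg_right hX (by positivity)
  have h7 : 2 / ε * (ε / 2 * (1 + ε)) = 1 + ε := by field_simp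
  nlinarith [h5, h6, h7, hε]

/-- **B2 ⟹ linear saturation** (B1 is the landed theorem `stub_boxSusceptibilityFloor`): the registered,
hypothesis-free stub `LinRiccatiSaturation` alone gives `e^{lin} → 1`. -/
theorem linSaturation_of_riccati (h2 : LinRiccatiSaturation) :
    ∀ ε : ℝ, 0 < ε → ∃ p₀ : ℝ, 0 < p₀ ∧ ∀ p : ℝ, 0 < p → p < p₀ → ∃ L₀ : ℕ, ∀ L ≥ L₀,
      1 - ε ≤ linEff L ⌈p * ((box 3 L).card : ℝ)⌉₊ :=
  linSaturation_of_floor_of_riccati stub_boxSusceptibilityFloor h2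

/-! ### The crux, hypothesis-free: `crux ⟺ 0636 ∨ (e^{lin} → 1 ∧ e^{gap} → 0)` -/

/-- **Unconditional anatomy of the crux.** `GaussianPinningSaturation` holds iff either item 0636 holds (every
non-degenerate pointwise scaling limit of `criticalCorr 3` is non-Gaussian) or, on the lattice and with no
scaling-limit hypothesis at all, the linear efficiency saturates AND the planted regression becomes linear
(`e^{gap} → 0`). The route's r2 denies the second disjunct. -/
theorem gaussianPinningSaturation_iff_R4NonGaussian_or_lin_and_gap :
    GaussianPinningSaturation ↔
      (IsingEuclidUpgradeR4NonGaussian ∨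
        ((∀ ε : ℝ, 0 < ε → ∃ p₀ : ℝ, 0 < p₀ ∧ ∀ p : ℝ, 0 < p → p < p₀ → ∃ L₀ : ℕ, ∀ L ≥ L₀,
            1 - ε ≤ linEff L ⌈p * ((box 3 L).card : ℝ)⌉₊) ∧
          ∀ ε : ℝ, 0 < ε → ∃ p₀ : ℝ, 0 < p₀ ∧ ∀ p : ℝ, 0 < p → p < p₀ → ∃ L₀ : ℕ, ∀ L ≥ L₀,
            gapEff L ⌈p * ((box 3 L).card : ℝ)⌉₊ ≤ ε)) := by
  rw [gaussianPinningSaturation_iff_R4NonGaussian_or_latticeSaturation, latticeSaturation_iff_lin_and_gap]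

/-- Registered bookkeeping stub `stub_cruxIffR4NonGaussianOrLinAndGap` of the crux item (lead seat c2): the
hypothesis-free anatomy of the crux, keyed by its registered name
(= `gaussianPinningSaturation_iff_R4NonGaussian_or_lin_and_gap`). -/
theorem stub_cruxIffR4NonGaussianOrLinAndGap : GaussianPinningSaturation ↔ (IsingEuclidUpgradeR4NonGaussian ∨ ((∀ ε : ℝ, 0 < ε → ∃ p₀ : ℝ, 0 < p₀ ∧ ∀ p : ℝ, 0 < p → p < p₀ → ∃ L₀ : ℕ, ∀ L ≥ L₀, 1 - ε ≤ linEff L ⌈p * ((box 3 L).card : ℝ)⌉₊) ∧ ∀ ε : ℝ, 0 < ε → ∃ p₀ : ℝ, 0 < p₀ ∧ ∀ p : ℝ, 0 < p → p < p₀ → ∃ L₀ : ℕ, ∀ L ≥ L₀, gapEff L ⌈p * ((box 3 L).card : ℝ)⌉₊ ≤ ε)) :=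
  gaussianPinningSaturation_iff_R4NonGaussian_or_lin_and_gap

/-- **Hypothesis-free sufficient conditions (what the line can honestly deliver without 0636).** The registered
stub B2 `LinRiccatiSaturation` together with lattice conditional linearity `e^{gap} → 0` (the lattice content of
stub C, with its vacuous scaling-limit hypotheses dropped) proves the crux. -/
theorem gaussianPinningSaturation_of_riccati_of_gap (h2 : LinRiccatiSaturation)
    (hgap : ∀ ε : ℝ, 0 < ε → ∃ p₀ : ℝ, 0 < p₀ ∧ ∀ p : ℝ, 0 < p → p < p₀ → ∃ L₀ : ℕ, ∀ L ≥ L₀,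
      gapEff L ⌈p * ((box 3 L).card : ℝ)⌉₊ ≤ ε) :
    GaussianPinningSaturation :=
  gaussianPinningSaturation_iff_R4NonGaussian_or_lin_and_gap.2 (Or.inr ⟨linSaturation_of_riccati h2, hgap⟩)

/-- **Under r2, B2 refutes lattice conditional linearity**: given `PinningEfficiencyDeficit` and
`LinRiccatiSaturation`, the planted regression gap does NOT vanish — `e^{gap} ↛ 0` is then exactly the route's
"positive Cauchy–Schwarz slack" `1 − e*`, carried entirely by the nonlinear part of the planted regression. -/
theorem not_gapVanishing_of_deficit_of_riccati (hdef : PinningEfficiencyDeficit) (h2 : LinRiccatiSaturation) :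
    ¬ ∀ ε : ℝ, 0 < ε → ∃ p₀ : ℝ, 0 < p₀ ∧ ∀ p : ℝ, 0 < p → p < p₀ → ∃ L₀ : ℕ, ∀ L ≥ L₀,
        gapEff L ⌈p * ((box 3 L).card : ℝ)⌉₊ ≤ ε :=
  fun hgap => not_latticeSaturation_of_deficit hdef
    (latticeSaturation_iff_lin_and_gap.2 ⟨linSaturation_of_riccati h2, hgap⟩)

end Summit.CriticalPhenomena.Ising3DConformalLimit.PlantedPinningGaussianPinningSaturation

end
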